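import Mathlib
import Summits.NavierStokesRegularity.NavierStokesRegularity.Theorems.EulerZoomLiouvillePowerGaugeEulerLiouvilleSelfSimilarRadialBarrierLoc
import Summits.NavierStokesRegularity.NavierStokesRegularity.Theorems.EulerZoomLiouvillePowerGaugeEulerLiouvilleSelfSimilarVorticalEscape
import HarnessLib.Audit

/-!
# Rung C1 of the crux `EulerZoomLiouville.PowerGaugeEulerLiouville` (the `C²` needle residue): BARRIER SPHERES BEYOND EVERY RADIUS
# SUFFICE — a `C²` self-similar Euler profile admitting inflow-free spheres `S_R` for arbitrarily large `R` is irrotational, hence trivial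

Route №10 `EulerZoomLiouville` (NavierStokesRegularity), crux E = stmt-NavierStokesRegularity-19832, registered residue
`stub_selfSimilarC2Needle` (THE ONE STATEMENT, skeleton v37 of the interim LEAD ns-typeII-p2 g10).  The tame disjunct of
ns-typeII-p1 g8's `…SelfSimilarRadialBarrierLoc` asks for the one-sided radial barrier `⟪y, U y⟫ ≥ −κ‖y‖²` at EVERY point beyond
some radius.  This file widens it to a SEQUENCE OF BARRIER SPHERES: it suffices that for some `κ < γ` and radii `R` beyond every
bound, `⟪y, U y⟫ ≥ −κ‖y‖²` holds ON THE SPHERE `‖y‖ = R` (nothing between the spheres).  Consequently the negation carried by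
THE ONE STATEMENT becomes the sharp needle portrait: for EVERY `κ < γ` the fast-inflow set `{⟪y, U y⟫ < −κ‖y‖²}` meets EVERY
sufficiently large sphere (previously a portrait of the backward orbits, `…SelfSimilarInflowVisits`; now the registered hypothesis).

Mechanism (no new dynamics): by continuity the strict barrier on the compact sphere `S_R` thickens to an annulus `R ≤ ‖y‖ ≤ R + w`
with a slightly larger `κ′ < γ` (`sphere_barrier_thickening`); the cutoff field `Ṽ = χU` (`χ = 1` on `B(0, R + w/2)`, `χ = 0` off
`B(0, R + w)`, `exists_cutoff_annulus_smul`) then satisfies the barrier at EVERY `‖y‖ ≥ R` (it vanishes outside the annulus), so the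
lineage's fencing lemma `norm_flow_le_max_of_nonpos_of_inner` confines every backward `Ṽ`-orbit issued from `B(0,R)` to `B̄(0,R)`, where
`Ṽ = U`: every point of `B(0, R)` admits a backward half-orbit of `W = γy + U` confined to `‖y‖ ≤ R`.  ns-typeII-p1 g8's
`volume_vortical_confined_eq_zero` (vortical points with a confined backward half-orbit are Lebesgue-null) makes the vortical set null in
`B(0,R)`, open, hence empty; `R` beyond every bound gives `curl U ≡ 0` (`curl_eq_zero_of_sphereBarriers`), and the LEAD's growth-free
endgame `Loc.selfSimilar_ae_eq_zero_of_irrotationalC2_profile` kills the member (`selfSimilar_ae_eq_zero_of_sphereBarriersC2_profile`).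

WHAT THIS IS NOT: not NS, not E, not rung C1 — a widening of one tame disjunct; `C²` profiles whose κ-needles pierce every large
sphere for every `κ < γ`, the weak class and the non-self-similar members remain. [folklore; ConstantinIgnatovaVicol2026Putative §3.4–§3.5 (setting)]
-/

noncomputable section

set_option linter.dupNamespace false

open MeasureTheory Set Filter Topology Metric Function InnerProductSpace
open scoped RealInnerProductSpace NNReal ENNReal ContDiff

namespace Summit.NavierStokesRegularity.NavierStokesRegularity.Theorems.PowerGaugeEulerLiouville.Loc

open Literature.Analysis Literature.Analysis.FluidPDE
open Summit.NavierStokesRegularity.NavierStokesRegularity.Theorems.PowerGaugeEulerLiouville.Kelvin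

variable {γ : ℝ} {U : EuclideanSpace ℝ (Fin 3) → EuclideanSpace ℝ (Fin 3)} {P : EuclideanSpace ℝ (Fin 3) → ℝ}

/-! ### Cutoff supported in a prescribed annulus; thickening of a strict sphere barrier -/

/-- **Cutoff with a scalar factor and prescribed shell**: for `0 < r₁ < r₂`, a `C²` field `U` agrees on `ball 0 r₁` with a `C²`
field `Ṽ = χ U` that is bounded, has globally bounded gradient, is everywhere a multiple `c • U y` (`0 ≤ c ≤ 1`) of `U y`, and
VANISHES for `‖y‖ > r₂`. [folklore] -/
theorem exists_cutoff_annulus_smul (hU : ContDiff ℝ 2 U) {r₁ r₂ : ℝ} (hr₁ : 0 < r₁) (hr₁₂ : r₁ < r₂) :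
    ∃ V : EuclideanSpace ℝ (Fin 3) → EuclideanSpace ℝ (Fin 3), ContDiff ℝ 2 V ∧ (∃ M : ℝ, ∀ y, ‖V y‖ ≤ M) ∧
      (∀ y, ∃ c : ℝ, 0 ≤ c ∧ c ≤ 1 ∧ V y = c • U y) ∧ (∃ K : ℝ, ∀ y, ‖fderiv ℝ V y‖ ≤ K) ∧
      (∀ y ∈ ball (0 : EuclideanSpace ℝ (Fin 3)) r₁, V y = U y) ∧ ∀ y, r₂ < ‖y‖ → V y = 0 := by
  -- adapted from `exists_cutoff_local_smul` (…SelfSimilarRadialBarrierLoc)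
  let χ : ContDiffBump (0 : EuclideanSpace ℝ (Fin 3)) := ⟨r₁, r₂, hr₁, hr₁₂⟩
  set V : EuclideanSpace ℝ (Fin 3) → EuclideanSpace ℝ (Fin 3) := fun y => χ y • U y with hVdef
  have hV : ContDiff ℝ 2 V := (χ.contDiff (n := 2)).smul hU
  have hzero : ∀ y : EuclideanSpace ℝ (Fin 3), r₂ < ‖y‖ → V =ᶠ[𝓝 y] fun _ => 0 := by
    intro y hy
    have hopen : IsOpen {y' : EuclideanSpace ℝ (Fin 3) | r₂ < ‖y'‖} := isOpen_lt continuous_const continuous_norm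
    filter_upwards [hopen.mem_nhds hy] with y' hy'
    have hns : y' ∉ Function.support (χ : EuclideanSpace ℝ (Fin 3) → ℝ) := by
      rw [χ.support_eq, mem_ball, dist_zero_right]
      exact not_lt.2 (le_of_lt hy')
    rw [Function.notMem_support] at hns
    simp [hVdef, hns]
  refine ⟨V, hV, ?_, fun y => ?_, ?_, fun y hy => ?_, fun y hy => ?_⟩
  · obtain ⟨C, hC⟩ := (isCompact_closedBall (0 : EuclideanSpace ℝ (Fin 3)) (r₂ + 1)).exists_bound_of_continuousOn
      hV.continuous.continuousOn
    refine ⟨max C 0, fun y => ?_⟩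
    by_cases hy : ‖y‖ ≤ r₂ + 1
    · exact (hC y (by rwa [mem_closedBall, dist_zero_right])).trans (le_max_left _ _)
    · push Not at hy
      rw [(hzero y (by linarith)).self_of_nhds, norm_zero]
      exact le_max_right _ _
  · exact ⟨χ y, χ.nonneg, χ.le_one, rfl⟩
  · have hDVc : Continuous (fderiv ℝ V) := hV.continuous_fderiv (by norm_num)
    obtain ⟨C, hC⟩ := (isCompact_closedBall (0 : EuclideanSpace ℝ (Fin 3)) (r₂ + 1)).exists_bound_of_continuousOn
      hDVc.continuousOn
    refine ⟨max C 0, fun y => ?_⟩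
    by_cases hy : ‖y‖ ≤ r₂ + 1
    · exact (hC y (by rwa [mem_closedBall, dist_zero_right])).trans (le_max_left _ _)
    · push Not at hy
      rw [(hzero y (by linarith)).fderiv_eq, fderiv_const_apply, norm_zero]
      exact le_max_right _ _
  · rw [mem_ball, dist_zero_right] at hy
    have h1 : χ y = 1 := χ.one_of_mem_closedBall (by rw [mem_closedBall, dist_zero_right]; exact hy.le)
    simp [hVdef, h1]
  · exact (hzero y hy).self_of_nhds

/-- **A strict barrier on one sphere thickens to an annulus**: if `U` is continuous and `⟪y, U y⟫ ≥ −κ‖y‖²` on the sphere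
`‖y‖ = R > 0`, then for every `κ′ > κ` there is `w > 0` with `⟪y, U y⟫ ≥ −κ′‖y‖²` on the annulus `R ≤ ‖y‖ ≤ R + w` (the continuous
function `⟪y, U y⟫ + κ′‖y‖²` is positive on the compact sphere, hence on a thickening of it). [folklore] -/
theorem sphere_barrier_thickening (hU : Continuous U) {κ κ' R : ℝ} (hκ : κ < κ') (hR : 0 < R)
    (hS : ∀ y : EuclideanSpace ℝ (Fin 3), ‖y‖ = R → -(κ * ‖y‖ ^ 2) ≤ ⟪y, U y⟫) :
    ∃ w : ℝ, 0 < w ∧ ∀ y : EuclideanSpace ℝ (Fin 3), R ≤ ‖y‖ → ‖y‖ ≤ R + w → -(κ' * ‖y‖ ^ 2) ≤ ⟪y, U y⟫ := by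
  set f : EuclideanSpace ℝ (Fin 3) → ℝ := fun y => ⟪y, U y⟫ + κ' * ‖y‖ ^ 2 with hf
  have hfc : Continuous f := (continuous_id.inner hU).add (continuous_const.mul (continuous_norm.pow 2))
  set T : Set (EuclideanSpace ℝ (Fin 3)) := {y | 0 < f y} with hT
  have hTo : IsOpen T := isOpen_lt continuous_const hfc
  have hST : sphere (0 : EuclideanSpace ℝ (Fin 3)) R ⊆ T := by
    intro y hy
    rw [mem_sphere_zero_iff_norm] at hy
    have h1 := hS y hy
    show 0 < ⟪y, U y⟫ + κ' * ‖y‖ ^ 2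
    have hpos : 0 < (κ' - κ) * ‖y‖ ^ 2 := mul_pos (by linarith) (by rw [hy]; positivity)
    nlinarith
  obtain ⟨δ, hδ, hthick⟩ := (isCompact_sphere (0 : EuclideanSpace ℝ (Fin 3)) R).exists_thickening_subset_open hTo hST
  refine ⟨δ / 2, by positivity, fun y hy1 hy2 => ?_⟩
  have hy0 : 0 < ‖y‖ := lt_of_lt_of_le hR hy1
  -- the radial projection of `y` onto the sphere is `δ`-close
  have hmem : y ∈ thickening δ (sphere (0 : EuclideanSpace ℝ (Fin 3)) R) := by
    rw [mem_thickening_iff]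
    refine ⟨(R / ‖y‖) • y, ?_, ?_⟩
    · rw [mem_sphere_zero_iff_norm, norm_smul, Real.norm_eq_abs, abs_of_pos (div_pos hR hy0),
        div_mul_cancel₀ _ hy0.ne']
    · have h1 : y - (R / ‖y‖) • y = (1 - R / ‖y‖) • y := by rw [sub_smul, one_smul]
      have h2 : 0 ≤ 1 - R / ‖y‖ := by rw [sub_nonneg, div_le_one hy0]; exact hy1
      rw [dist_eq_norm, h1, norm_smul, Real.norm_eq_abs, abs_of_nonneg h2, sub_mul, one_mul,
        div_mul_cancel₀ _ hy0.ne']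
      linarith
  have hfy : 0 < f y := hthick hmem
  show -(κ' * ‖y‖ ^ 2) ≤ ⟪y, U y⟫
  have : 0 < ⟪y, U y⟫ + κ' * ‖y‖ ^ 2 := hfy
  linarith

/-! ### Barrier spheres beyond every radius ⇒ irrotational -/

/-- **BARRIER SPHERES BEYOND EVERY RADIUS MAKE A `C²` SELF-SIMILAR EULER PROFILE IRROTATIONAL.**  `(U, P)` a `C²` profile of
CIV (3.3) with `0 < γ < ½`; suppose that for some `κ < γ` there are radii `R` beyond every bound with `⟪y, U y⟫ ≥ −κ‖y‖²` for all
`‖y‖ = R`.  Then `curl U ≡ 0`.  (Each barrier sphere confines the backward half-orbits issued from its interior — run on the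
cutoff field, which satisfies the barrier at every larger radius too — so the vortical points inside are null by
`volume_vortical_confined_eq_zero`, open, empty.) [folklore] -/
theorem curl_eq_zero_of_sphereBarriers (hprof : IsSelfSimilarEulerProfile γ 0 U P) {κ : ℝ} (hκ : κ < γ)
    (hS : ∀ R₀ : ℝ, ∃ R : ℝ, R₀ ≤ R ∧ ∀ y : EuclideanSpace ℝ (Fin 3), ‖y‖ = R → -(κ * ‖y‖ ^ 2) ≤ ⟪y, U y⟫)
    (hγ : 0 < γ) (hγ2 : γ < 1 / 2) (x₀ : EuclideanSpace ℝ (Fin 3)) : curl U x₀ = 0 := by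
  have hU2 : ContDiff ℝ 2 U := hprof.contDiff_velocity
  have hU1 : ContDiff ℝ 1 U := hU2.of_le (by norm_num)
  -- a barrier sphere of radius `R ≥ ‖x₀‖ + 1`, `R ≥ 1`
  obtain ⟨R, hR₀, hSR⟩ := hS (max (‖x₀‖ + 1) 1)
  have hR1 : 1 ≤ R := (le_max_right _ _).trans hR₀
  have hRx : ‖x₀‖ + 1 ≤ R := (le_max_left _ _).trans hR₀
  have hR : 0 < R := by linarith
  -- thicken with the intermediate rate `κ′ = (max κ 0 + γ)/2 ∈ [0, γ)`, `κ < κ′`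
  set κ' : ℝ := (max κ 0 + γ) / 2 with hκ'
  have hκ0 : max κ 0 < γ := max_lt hκ hγ
  have hκκ' : κ < κ' := by have := le_max_left κ 0; rw [hκ']; linarith
  have hκ'0 : 0 ≤ κ' := by have := le_max_right κ 0; rw [hκ']; linarith
  have hκ'γ : κ' < γ := by rw [hκ']; linarith
  obtain ⟨w₀, hw₀, hann₀⟩ := sphere_barrier_thickening hU2.continuous hκκ' hR hSR
  set w : ℝ := min w₀ 1 with hw
  have hw0 : 0 < w := lt_min hw₀ one_pos
  have hww₀ : w ≤ w₀ := min_le_left _ _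
  have hann : ∀ y : EuclideanSpace ℝ (Fin 3), R ≤ ‖y‖ → ‖y‖ ≤ R + w → -(κ' * ‖y‖ ^ 2) ≤ ⟪y, U y⟫ :=
    fun y h1 h2 => hann₀ y h1 (h2.trans (by linarith))
  -- the cutoff field: `= U` on `ball 0 (R + w/2)`, `= 0` beyond `R + w`
  obtain ⟨V, hV, ⟨M, hVM⟩, hVmul, ⟨K, hK⟩, hagree, hvan⟩ :=
    exists_cutoff_annulus_smul hU2 (r₁ := R + w / 2) (r₂ := R + w) (by linarith) (by linarith)
  have hV1 : ContDiff ℝ 1 V := hV.of_le (by norm_num)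
  have hfarV : ∀ y : EuclideanSpace ℝ (Fin 3), R ≤ ‖y‖ → -(κ' * ‖y‖ ^ 2) ≤ ⟪y, V y⟫ := by
    intro y hy
    by_cases hy2 : ‖y‖ ≤ R + w
    · obtain ⟨c, hc0, hc1, hcy⟩ := hVmul y
      rw [hcy, inner_smul_right]
      have h1 := hann y hy hy2
      have h2 : 0 ≤ κ' * ‖y‖ ^ 2 := mul_nonneg hκ'0 (sq_nonneg _)
      nlinarith
    · push Not at hy2
      rw [hvan y hy2, inner_zero_right]
      have h2 : 0 ≤ κ' * ‖y‖ ^ 2 := mul_nonneg hκ'0 (sq_nonneg _)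
      linarith
  have hWeq : ∀ z : EuclideanSpace ℝ (Fin 3), ‖z‖ < R + w / 2 →
      selfSimilarTransport γ 0 V z = selfSimilarTransport γ 0 U z := by
    intro z hz
    simp only [selfSimilarTransport_apply, hagree z (by rwa [mem_ball, dist_zero_right])]
  set Φ := ODE.evolutionMap (fun _ : ℝ => selfSimilarTransport γ 0 V) 0 with hΦ
  -- every vortical point near `x₀` has a backward `U`-half-orbit confined to `‖y‖ ≤ R`
  have hsubset : {x : EuclideanSpace ℝ (Fin 3) | dist x x₀ < 1 ∧ curl U x ≠ 0} ⊆
      {x : EuclideanSpace ℝ (Fin 3) | curl U x ≠ 0 ∧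
        ∃ Y : ℝ → EuclideanSpace ℝ (Fin 3), Y 0 = x ∧
          (∀ t, 0 ≤ t → HasDerivAt Y ((-1 : ℝ) • selfSimilarTransport γ 0 U (Y t)) t) ∧
          ∀ t, 0 ≤ t → ‖Y t‖ ≤ R} := by
    rintro x ⟨hx, hcx⟩
    have hxn : ‖x‖ ≤ ‖x₀‖ + 1 := by
      have := norm_le_norm_add_norm_sub' x x₀
      rw [← dist_eq_norm] at this
      linarith
    have hxR : max ‖x‖ R ≤ R := max_le (hxn.trans hRx) le_rfl
    set Yp : ℝ → EuclideanSpace ℝ (Fin 3) := fun t => Φ (-t) x with hYp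
    have hYpV : ∀ t, HasDerivAt Yp ((-1 : ℝ) • selfSimilarTransport γ 0 V (Yp t)) t :=
      fun t => C2.Kelvin.hasDerivAt_flow_neg (γ := γ) hV1 hK x t
    have hYp0 : Yp 0 = x := by simp [hYp, hΦ, ODE.evolutionMap_self]
    have hconf : ∀ t, 0 ≤ t → ‖Yp t‖ ≤ R := fun t ht =>
      (norm_flow_le_max_of_nonpos_of_inner hV1 hK hκ'γ hR hfarV x (s := -t) (by linarith)).trans hxR
    have hYpU : ∀ t, 0 ≤ t → HasDerivAt Yp ((-1 : ℝ) • selfSimilarTransport γ 0 U (Yp t)) t := by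
      intro t ht
      have h := hYpV t
      rwa [hWeq (Yp t) (by linarith [hconf t ht])] at h
    exact ⟨hcx, Yp, hYp0, hYpU, hconf⟩
  have hnull := volume_vortical_confined_eq_zero hprof hγ hγ2 hR
  -- an open null set is empty
  have hopen : IsOpen {x : EuclideanSpace ℝ (Fin 3) | dist x x₀ < 1 ∧ curl U x ≠ 0} := by
    have h1 : IsOpen {x : EuclideanSpace ℝ (Fin 3) | dist x x₀ < 1} := isOpen_lt (continuous_id.dist continuous_const) continuous_const
    exact h1.inter (isOpen_ne_fun (differentiable_curl_of_contDiff hU2).continuous continuous_const)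
  have hzero : volume {x : EuclideanSpace ℝ (Fin 3) | dist x x₀ < 1 ∧ curl U x ≠ 0} = 0 := measure_mono_null hsubset hnull
  have hempty := (hopen.measure_eq_zero_iff volume).1 hzero
  by_contra hx₀
  have : x₀ ∈ ({x : EuclideanSpace ℝ (Fin 3) | dist x x₀ < 1 ∧ curl U x ≠ 0} : Set _) := ⟨by simp, hx₀⟩
  rw [hempty] at this
  exact this

/-! ### Member level -/

/-- **MEMBER LEVEL — an exactly self-similar member of Seregin's power-gauged class with a `C²` velocity profile admitting BARRIER
SPHERES BEYOND EVERY RADIUS is trivial.**  Crux hypotheses verbatim (`0 < ρ ≤ ½`) + exact self-similarity + `V ∈ C²` + some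
`κ < 1/(2+ρ)` with `⟪y, V y⟫ ≥ −κ‖y‖²` on spheres `‖y‖ = R` for radii `R` beyond every bound ⇒ `u = 0` a.e.: the profile is irrotational
(`curl_eq_zero_of_sphereBarriers`, via the CIV profile `WeakToClassical.exists_isSelfSimilarEulerProfile_of_contDiff`) and the growth-free
endgame `Loc.selfSimilar_ae_eq_zero_of_irrotationalC2_profile` applies.  Widens `selfSimilar_ae_eq_zero_of_radialInflowC2_profile`
(barrier at every large point).  [folklore] -/
theorem selfSimilar_ae_eq_zero_of_sphereBarriersC2_profile {ρ : ℝ} (hρ : 0 < ρ) (hρ1 : ρ ≤ 1 / 2)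
    {u : ℝ → EuclideanSpace ℝ (Fin 3) → EuclideanSpace ℝ (Fin 3)} {p : ℝ → EuclideanSpace ℝ (Fin 3) → ℝ}
    {H : ℝ → EuclideanSpace ℝ (Fin 3) → EuclideanSpace ℝ (Fin 3) →L[ℝ] EuclideanSpace ℝ (Fin 3)} {c : ℝ≥0}
    (hsw : IsSuitableWeakSolutionOn (slab (EuclideanSpace ℝ (Fin 3)) (Iio 0) isOpen_Iio) 0 0 u p)
    (hgauge : ∀ a : ℝ, 0 < a →
      ENNReal.ofReal (a ^ (2 * ρ)) * cknA a (0 : ℝ × EuclideanSpace ℝ (Fin 3)) u +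
          ENNReal.ofReal (a ^ ρ) * cknE a (0 : ℝ × EuclideanSpace ℝ (Fin 3)) H +
        ENNReal.ofReal (a ^ (2 * ρ)) * cknD a (0 : ℝ × EuclideanSpace ℝ (Fin 3)) p ≤ (c : ℝ≥0∞))
    {V : EuclideanSpace ℝ (Fin 3) → EuclideanSpace ℝ (Fin 3)} {P : EuclideanSpace ℝ (Fin 3) → ℝ}
    (hu : ∀ τ : ℝ, τ < 0 → u τ = selfSimilarCollapse (1 / (2 + ρ)) 0 V τ)
    (hp : ∀ τ : ℝ, τ < 0 → p τ = selfSimilarCollapsePressure (1 / (2 + ρ)) 0 P τ)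
    (hV : ContDiff ℝ 2 V) {κ : ℝ} (hκ : κ < 1 / (2 + ρ))
    (hS : ∀ R₀ : ℝ, ∃ R : ℝ, R₀ ≤ R ∧ ∀ y : EuclideanSpace ℝ (Fin 3), ‖y‖ = R → -(κ * ‖y‖ ^ 2) ≤ ⟪y, V y⟫) :
    uncurry u =ᵐ[volume.restrict (Iio (0 : ℝ) ×ˢ (univ : Set (EuclideanSpace ℝ (Fin 3))))] 0 := by
  -- adapted from `selfSimilar_ae_eq_zero_of_radialInflowC2_profile` (…SelfSimilarRadialBarrierLoc)
  have hρ1' : ρ < 1 := by linarith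
  have h2ρ : (0 : ℝ) < 2 + ρ := by linarith
  have hγ : (0 : ℝ) < 1 / (2 + ρ) := one_div_pos.2 h2ρ
  have hγ2 : 1 / (2 + ρ) < 1 / 2 := one_div_lt_one_div_of_lt two_pos (by linarith)
  have hA : ∀ a : ℝ, 0 < a → ENNReal.ofReal (a ^ (2 * ρ)) *
      cknA a (0 : ℝ × EuclideanSpace ℝ (Fin 3)) u ≤ (c : ℝ≥0∞) :=
    fun a ha => le_trans (le_trans le_self_add le_self_add) (hgauge a ha)
  have hD : ∀ a : ℝ, 0 < a → ENNReal.ofReal (a ^ (2 * ρ)) *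
      cknD a (0 : ℝ × EuclideanSpace ℝ (Fin 3)) p ≤ (c : ℝ≥0∞) :=
    fun a ha => le_trans le_add_self (hgauge a ha)
  have hpm : AEStronglyMeasurable (uncurry p)
      (volume.restrict (Iio (0 : ℝ) ×ˢ (univ : Set (EuclideanSpace ℝ (Fin 3))))) := by
    have := hsw.distributional.2.2.1.aestronglyMeasurable
    simpa [slab] using this
  have hPm := aestronglyMeasurable_pressureProfile hpm hp
  have hDprof := profile_pressure_weight_of_gaugeD hρ hρ1' hpm hp hD
  have hP1 : LocallyIntegrable P volume :=
    EnergySaturation.locallyIntegrable_pressure_of_weight hρ1' hPm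
      (ENNReal.mul_ne_top ENNReal.ofReal_ne_top ENNReal.coe_ne_top) hDprof
  obtain ⟨P', hprof⟩ := WeakToClassical.exists_isSelfSimilarEulerProfile_of_contDiff hsw.distributional hu hp hV hP1
  have hcurl := curl_eq_zero_of_sphereBarriers hprof hκ hS hγ hγ2
  exact Loc.selfSimilar_ae_eq_zero_of_irrotationalC2_profile hρ hsw.distributional hA hu hV hcurl

end Summit.NavierStokesRegularity.NavierStokesRegularity.Theorems.PowerGaugeEulerLiouville.Loc
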